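import Literature.AnabelianGeometry.AbsoluteAnabelian.NeukirchUchidaKummerSeparation
import HarnessLib

/-!
# The Neukirch–Uchida deduction, row R10: a level-wise conjugator from the Kummer separation

J. Neukirch, A. Schmidt, K. Wingberg, *Cohomology of Number Fields* (2nd ed.), Thm. (12.2.1)
(Neukirch–Uchida), «finite-level conjugacy» step, abc-iut sub-DAG `plan/L4/SUBDAG-NeukirchUchida.md`
row R10.  SETTING (Γ-level, `Γ = G_F` acting on `F̄`): `V ≤ Γ` (the absolute Galois group of a finite
Galois `N`), `α` an automorphism of `V`, `W ⊴ Γ` with `W ≤ V` (the absolute Galois group of a finite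
Galois `M ⊇ N`); the prime correspondence of `α` at two nonarchimedean primes:
`α(D_{A₀} ∩ V) = D_{m₀•A₀} ∩ V`, `α(D_{A₁} ∩ V) = D_{m₁•A₁} ∩ V` (row R1); and the SEPARATION ORACLE of
row R9 at base `W` for the pairs `(a • A₀, A₁)`, `a ∈ V`: whenever `α(D_{a•A₀} ∩ V) = D_{m•a•A₀} ∩ V`, then
`m⁻¹ m₁ ∈ W` (`inv_mul_mem_of_map_stabilizer_eq`, `NeukirchUchidaKummerSeparation.lean`, fed with the
Chinese-remainder / Kummer / Frobenius data of rows R3, R8 at the field `M`).  CONCLUSION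
(`levelConjugator_of_separation`): `α(a) ≡ m₀ a m₀⁻¹ (mod W)` for every `a ∈ V` — `m₀` is a level-`M`
conjugator, the hypothesis `hlev` of `exists_forall_eq_conj_of_levelwise` (`NeukirchUchidaCoreAssembly.lean`).
The only ingredient beyond the oracle is the EQUIVARIANCE of the correspondence
(`map_stabilizer_smul_subgroupOf_eq`, row R1): `α(D_{a•A₀} ∩ V) = D_{α(a) m₀ • A₀} ∩ V`.

PROOF-ONLY (0 `def`s).  HONEST FRAMING: classical, outside the [IUTchIII] Cor. 3.12 cone; the oracle
`hsep` is row R9's theorem instantiated with data NOT constructed here; nothing here takes a side.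

## References
* [NeukirchSchmidtWingberg2008] Neukirch–Schmidt–Wingberg, *Cohomology of Number Fields*, Thm. (12.2.1).
-/

noncomputable section

open scoped Pointwise
open Field

namespace Literature.AnabelianGeometry.AbsoluteAnabelian

namespace NeukirchUchidaProof

variable {F : Type} [Field F]

/-- **A level-wise conjugator from the separation oracle** (row R10): with the correspondence
`α(D_{A₀} ∩ V) = D_{m₀•A₀} ∩ V` and the oracle «`α(D_{a•A₀} ∩ V) = D_{m•(a•A₀)} ∩ V ⇒ m⁻¹ m₁ ∈ W`» for all
`a ∈ V` (row R9 at the pairs `(a•A₀, A₁)`), the element `m₀` conjugates like `α` modulo `W`: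
`α(a)⁻¹ (m₀ a m₀⁻¹) ∈ W` for all `a ∈ V`. [cite: NeukirchSchmidtWingberg2008, Thm (12.2.1)] -/
theorem levelConjugator_of_separation {V W : Subgroup (absoluteGaloisGroup F)} [W.Normal]
    (α : V ≃* V) {A₀ : ValuationSubring (AlgebraicClosure F)} {m₀ m₁ : absoluteGaloisGroup F}
    (hπ₀ : ((MulAction.stabilizer (absoluteGaloisGroup F) A₀).subgroupOf V).map α.toMonoidHom =
      (MulAction.stabilizer (absoluteGaloisGroup F) (m₀ • A₀)).subgroupOf V)
    (hsep : ∀ (a : V) (m : absoluteGaloisGroup F),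
      ((MulAction.stabilizer (absoluteGaloisGroup F) ((a : absoluteGaloisGroup F) • A₀)).subgroupOf V).map
          α.toMonoidHom =
        (MulAction.stabilizer (absoluteGaloisGroup F) (m • (a : absoluteGaloisGroup F) • A₀)).subgroupOf V →
      m⁻¹ * m₁ ∈ W)
    (a : V) :
    ((α a : V) : absoluteGaloisGroup F)⁻¹ * (m₀ * a * m₀⁻¹) ∈ W := by
  -- the oracle at `a = 1`: `m₀⁻¹ m₁ ∈ W`
  have h1 : m₀⁻¹ * m₁ ∈ W := by
    refine hsep 1 m₀ ?_
    simpa only [OneMemClass.coe_one, one_smul] using hπ₀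
  -- equivariance: `α(D_{a•A₀} ∩ V) = D_{α(a) m₀ • A₀} ∩ V = D_{(α(a) m₀ a⁻¹) • (a • A₀)} ∩ V`
  have h2 := map_stabilizer_smul_subgroupOf_eq α hπ₀ a
  have h3 : ((α a : V) : absoluteGaloisGroup F) • m₀ • A₀ =
      (((α a : V) : absoluteGaloisGroup F) * m₀ * (a : absoluteGaloisGroup F)⁻¹) •
        (a : absoluteGaloisGroup F) • A₀ := by
    rw [smul_smul, smul_smul, inv_mul_cancel_right]
  rw [h3] at h2
  have h4 := hsep a _ h2
  -- group algebra in `Γ` with `W` normal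
  have h5 : ((a : absoluteGaloisGroup F) * m₀⁻¹ * ((α a : V) : absoluteGaloisGroup F)⁻¹ * m₁) *
      (m₀⁻¹ * m₁)⁻¹ ∈ W := W.mul_mem (by simpa [mul_inv_rev, mul_assoc] using h4) (W.inv_mem h1)
  have h6 : (a : absoluteGaloisGroup F) * m₀⁻¹ * ((α a : V) : absoluteGaloisGroup F)⁻¹ * m₀ ∈ W := by
    have : ((a : absoluteGaloisGroup F) * m₀⁻¹ * ((α a : V) : absoluteGaloisGroup F)⁻¹ * m₁) *
        (m₀⁻¹ * m₁)⁻¹ = (a : absoluteGaloisGroup F) * m₀⁻¹ * ((α a : V) : absoluteGaloisGroup F)⁻¹ * m₀ := by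
      group
    rw [this] at h5
    exact h5
  -- conjugate by `m₀`, then by `α(a)⁻¹`
  have h7 : ((α a : V) : absoluteGaloisGroup F) * m₀ * (a : absoluteGaloisGroup F)⁻¹ * m₀⁻¹ ∈ W := by
    have := Subgroup.Normal.conj_mem inferInstance _ (W.inv_mem h6) m₀
    have e : m₀ * ((a : absoluteGaloisGroup F) * m₀⁻¹ * ((α a : V) : absoluteGaloisGroup F)⁻¹ * m₀)⁻¹ *
        m₀⁻¹ = ((α a : V) : absoluteGaloisGroup F) * m₀ * (a : absoluteGaloisGroup F)⁻¹ * m₀⁻¹ := by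
      group
    rw [e] at this
    exact this
  have h8 := Subgroup.Normal.conj_mem inferInstance _ h7 (((α a : V) : absoluteGaloisGroup F))⁻¹
  have e : ((α a : V) : absoluteGaloisGroup F)⁻¹ *
      (((α a : V) : absoluteGaloisGroup F) * m₀ * (a : absoluteGaloisGroup F)⁻¹ * m₀⁻¹) *
        (((α a : V) : absoluteGaloisGroup F))⁻¹⁻¹ =
      (((α a : V) : absoluteGaloisGroup F)⁻¹ * (m₀ * a * m₀⁻¹))⁻¹ := by
    group
  rw [e] at h8
  exact (Subgroup.inv_mem_iff W).mp h8

/-- **Restriction of a partial isomorphism to an invariant subgroup** (bookkeeping for rows R6 ⇒ R9/R10: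
`α : U₁ ⥲ U₂` with `α(H ∩ U₁) = H ∩ U₂` for `H ≤ U₁ ∩ U₂` — e.g. `H = Gal(ℚ̄/M)`, `M/ℚ` finite Galois, by the
Galois invariance of row R6 — restricts to an automorphism `α_H` of `H` with the same values).
[cite: NeukirchSchmidtWingberg2008, Thm (12.2.1)] -/
theorem exists_mulEquiv_restrict {G : Type*} [Group G] {U₁ U₂ : Subgroup G} (α : U₁ ≃* U₂)
    (H : Subgroup G) (hH₁ : H ≤ U₁) (hH₂ : H ≤ U₂)
    (hαH : (H.subgroupOf U₁).map α.toMonoidHom = H.subgroupOf U₂) :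
    ∃ αH : H ≃* H, ∀ h : H, ((αH h : H) : G) = ((α ⟨(h : G), hH₁ h.2⟩ : U₂) : G) := by
  have hfwd : ∀ h : H, ((α ⟨(h : G), hH₁ h.2⟩ : U₂) : G) ∈ H := fun h => by
    have : α ⟨(h : G), hH₁ h.2⟩ ∈ (H.subgroupOf U₁).map α.toMonoidHom :=
      ⟨⟨(h : G), hH₁ h.2⟩, h.2, rfl⟩
    rw [hαH] at this
    exact this
  have hsymm : (H.subgroupOf U₂).map α.symm.toMonoidHom = H.subgroupOf U₁ := by
    rw [← hαH, Subgroup.map_map]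
    have : α.symm.toMonoidHom.comp α.toMonoidHom = MonoidHom.id U₁ := by ext; simp
    rw [this, Subgroup.map_id]
  have hbwd : ∀ h : H, ((α.symm ⟨(h : G), hH₂ h.2⟩ : U₁) : G) ∈ H := fun h => by
    have : α.symm ⟨(h : G), hH₂ h.2⟩ ∈ (H.subgroupOf U₂).map α.symm.toMonoidHom :=
      ⟨⟨(h : G), hH₂ h.2⟩, h.2, rfl⟩
    rw [hsymm] at this
    exact this
  refine ⟨{ toFun := fun h => ⟨_, hfwd h⟩
            invFun := fun h => ⟨_, hbwd h⟩
            left_inv := fun h => ?_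
            right_inv := fun h => ?_
            map_mul' := fun h h' => ?_ }, fun h => rfl⟩
  · apply Subtype.ext
    change ((α.symm ⟨((α ⟨(h : G), hH₁ h.2⟩ : U₂) : G), _⟩ : U₁) : G) = (h : G)
    have : (⟨((α ⟨(h : G), hH₁ h.2⟩ : U₂) : G), hH₂ (hfwd h)⟩ : U₂) = α ⟨(h : G), hH₁ h.2⟩ :=
      Subtype.ext rfl
    rw [this, α.symm_apply_apply]
  · apply Subtype.ext
    change ((α ⟨((α.symm ⟨(h : G), hH₂ h.2⟩ : U₁) : G), _⟩ : U₂) : G) = (h : G)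
    have : (⟨((α.symm ⟨(h : G), hH₂ h.2⟩ : U₁) : G), hH₁ (hbwd h)⟩ : U₁) = α.symm ⟨(h : G), hH₂ h.2⟩ :=
      Subtype.ext rfl
    rw [this, α.apply_symm_apply]
  · apply Subtype.ext
    change ((α ⟨(h : G) * (h' : G), _⟩ : U₂) : G) =
      ((α ⟨(h : G), hH₁ h.2⟩ : U₂) : G) * ((α ⟨(h' : G), hH₁ h'.2⟩ : U₂) : G)
    have : (⟨(h : G) * (h' : G), hH₁ (H.mul_mem h.2 h'.2)⟩ : U₁) =
        ⟨(h : G), hH₁ h.2⟩ * ⟨(h' : G), hH₁ h'.2⟩ := rfl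
    rw [this, map_mul]
    rfl

end NeukirchUchidaProof

end Literature.AnabelianGeometry.AbsoluteAnabelian

end
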